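import Mathlib
import Summits.PneNP.PneNP.Theorems.ClusUniversalCertificateCoordBox
import Summits.PneNP.PneNP.Theorems.ClusUniversalCertificateCoordSupply
import Summits.PneNP.PneNP.Theorems.ClusUniversalCertificateCoordSaturation

/-!
# Route ClusUniversalCertificate, crux `UniversalCertAll` (stmt-PneNP-19683) — skew and saturation for arbitrary missed patterns

Support file (`--supports stmt-PneNP-19683`); objects of record `…Theorems.ClusCoord` (`bsize`, `zcount`), block projection `ClusCoordZeroFree.blockProj`,
the skew lemma `ClusCoordBox.bsize_add_le_finrank_inf` (zero-avoiding form), `ClusCoordSupply.finrank_range_blockProj_le` and the saturation bound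
`ClusCoordSaturation.card_sat_le`.

A flat `A` is NOT ONTO block `k` iff it misses some pattern there; translating by the missed patterns reduces to the zero-avoiding case.  This file records
the pattern-general statements a successor needs to speak about ONTO blocks and SKEW (`skew := acodim − #{blocks not onto}`) without normalising `Y`:
* `finrank_range_blockProj_eq` : `dim (range π_k) = b_k`;
* `bsize_add_le_finrank_inf_of_missed` : if `A ∋ y` misses the pattern `p` on every block of `J` then for every `k ∉ J`,
  `b_k + dim A + |J| ≤ dim (A.direction ⊓ range π_k) + M` (a flat of skew `s` w.r.t. `J` is `2^{−s}`-saturated in every other block);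
* `sat_of_tight_of_missed` : if moreover `dim A + |J| ≥ M` (skew `0`) and `A ⊆ Y`, every point of `A` is `k`-saturated in `Y` for every `k ∉ J`;
* `card_skewZero_le` : the points of `Y` carrying such a skew-`0` flat number at most `2^{b_k} · #(any block-k fibre of Y)` — the single-block level
  `excess_k ≤ Σ_{y onto k} skew(y)` of the skew form `Σ_j excess_j ≤ Σ_y skew(y)` of the certificate in min-fibre (μ) form (folder census 2026-08-31).
HONEST FRAMING: support lemmas; the crux is OPEN; FRONTIER rung F-N1 — nothing here bears on P vs NP.
-/

set_option linter.dupNamespace false -- `Summit.PneNP.PneNP.…`: summit = sub-problem name (D-0017 single-conjunct layout)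

namespace Summit.PneNP.PneNP.Theorems.ClusCoordSkewSat

open Finset Pointwise
open Summit.PneNP.PneNP.Theorems.ClusCoord (bsize zcount)
open Summit.PneNP.PneNP.Theorems.ClusCoordZeroFree (blockProj blockProj_apply blockProj_eq_zero_iff)
open Summit.PneNP.PneNP.Theorems.ClusCoordBox (bsize_add_le_finrank_inf bsize_le_finrank_range_blockProj)
open Summit.PneNP.PneNP.Theorems.ClusCoordSupply (finrank_range_blockProj_le)
open Summit.PneNP.PneNP.Theorems.ClusCoordSaturation (card_sat_le)

variable {M n : ℕ}

/-- The block-`k` projection has rank exactly `b_k`. -/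
theorem finrank_range_blockProj_eq (blk : Fin M → Fin n) (k : Fin n) :
    Module.finrank (ZMod 2) (LinearMap.range (blockProj blk k)) = bsize blk k :=
  le_antisymm (finrank_range_blockProj_le blk k) (bsize_le_finrank_range_blockProj blk k)

/-- **Skew lemma, arbitrary missed patterns.**  If the flat `A ∋ y` misses the pattern `p` on every block of `J`, then for every block `k ∉ J`,
`b_k + dim A + |J| ≤ dim (A.direction ⊓ range π_k) + M`. -/
theorem bsize_add_le_finrank_inf_of_missed (blk : Fin M → Fin n) (A : AffineSubspace (ZMod 2) (Fin M → ZMod 2))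
    (y : Fin M → ZMod 2) (hy : y ∈ A) (J : Finset (Fin n)) (p : Fin M → ZMod 2)
    (hJ : ∀ j ∈ J, ∀ z ∈ A, ¬ (∀ i, blk i = j → z i = p i)) (k : Fin n) (hk : k ∉ J) :
    bsize blk k + Module.finrank (ZMod 2) A.direction + J.card ≤
      Module.finrank (ZMod 2) (A.direction ⊓ LinearMap.range (blockProj blk k) : Submodule (ZMod 2) (Fin M → ZMod 2)) + M := by
  -- translate by `−p`: the flat `(−p) +ᵥ A` through `(−p) +ᵥ y` is zero-avoiding on `J` and has the same direction
  have hy' : (-p) +ᵥ y ∈ (-p) +ᵥ A := AffineSubspace.vadd_mem_pointwise_vadd_iff.mpr hy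
  have hJ' : ∀ j ∈ J, ∀ z ∈ (-p) +ᵥ A, ¬ (∀ i, blk i = j → z i = 0) := by
    intro j hj z hz hz0
    rw [← SetLike.mem_coe, AffineSubspace.coe_pointwise_vadd, Set.mem_vadd_set] at hz
    obtain ⟨q, hq, rfl⟩ := hz
    apply hJ j hj q hq
    intro i hi
    have := hz0 i hi
    rw [vadd_eq_add, Pi.add_apply, Pi.neg_apply, neg_add_eq_sub, sub_eq_zero] at this
    exact this
  have h := bsize_add_le_finrank_inf blk ((-p) +ᵥ A) ((-p) +ᵥ y) hy' J hJ' k hk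
  rwa [AffineSubspace.pointwise_vadd_direction] at h

/-- **Saturation at skew 0, arbitrary missed patterns.**  If the flat `A ⊆ Y` misses the pattern `p` on every block of `J` and `dim A + |J| ≥ M`,
then every point of `A` is `k`-saturated in `Y` for every block `k ∉ J`. -/
theorem sat_of_tight_of_missed (blk : Fin M → Fin n) (Y : Finset (Fin M → ZMod 2)) (A : AffineSubspace (ZMod 2) (Fin M → ZMod 2))
    (hA : ∀ z ∈ A, z ∈ Y) (y : Fin M → ZMod 2) (hy : y ∈ A) (J : Finset (Fin n)) (p : Fin M → ZMod 2)
    (hJ : ∀ j ∈ J, ∀ z ∈ A, ¬ (∀ i, blk i = j → z i = p i))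
    (htight : M ≤ Module.finrank (ZMod 2) A.direction + J.card)
    (a : Fin M → ZMod 2) (ha : a ∈ A) (k : Fin n) (hk : k ∉ J)
    (w : Fin M → ZMod 2) (hw : ∀ i, blk i ≠ k → w i = 0) : a + w ∈ Y := by
  -- the direction contains the whole range of `π_k`
  have h := bsize_add_le_finrank_inf_of_missed blk A y hy J p hJ k hk
  have hle : (A.direction ⊓ LinearMap.range (blockProj blk k) : Submodule (ZMod 2) (Fin M → ZMod 2)) ≤
      LinearMap.range (blockProj blk k) := inf_le_right
  have heq : (A.direction ⊓ LinearMap.range (blockProj blk k) : Submodule (ZMod 2) (Fin M → ZMod 2)) =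
      LinearMap.range (blockProj blk k) := by
    apply Submodule.eq_of_le_of_finrank_le hle
    rw [finrank_range_blockProj_eq]
    omega
  have hwr : w ∈ LinearMap.range (blockProj blk k) := by
    refine ⟨w, ?_⟩
    funext i
    rw [blockProj_apply]
    by_cases hi : blk i = k
    · rw [if_pos hi]
    · rw [if_neg hi, hw i hi]
  have hwd : w ∈ A.direction := by
    have : w ∈ (A.direction ⊓ LinearMap.range (blockProj blk k) : Submodule (ZMod 2) (Fin M → ZMod 2)) := by
      rw [heq]; exact hwr
    exact (Submodule.mem_inf.mp this).1
  have := AffineSubspace.vadd_mem_of_mem_direction hwd ha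
  rw [vadd_eq_add, add_comm] at this
  exact hA _ this

open Classical in
/-- **Single-block level of the skew form (μ-form).**  The points of `Y` carrying a skew-`0` flat w.r.t. a block set `J ∌ k` (a flat inside `Y` missing
one pattern on every block of `J`, with `dim + |J| ≥ M`) are `k`-saturated, hence number at most `2^{b_k}` times ANY block-`k` fibre of `Y`. -/
theorem card_skewZero_le (blk : Fin M → Fin n) (k : Fin n) (J : Finset (Fin n)) (hk : k ∉ J)
    (Y : Finset (Fin M → ZMod 2)) (x : Fin M → ZMod 2) :
    (Y.filter fun y => ∃ A : AffineSubspace (ZMod 2) (Fin M → ZMod 2), ∃ p : Fin M → ZMod 2,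
        y ∈ A ∧ (∀ z ∈ A, z ∈ Y) ∧ M ≤ Module.finrank (ZMod 2) A.direction + J.card ∧
        ∀ j ∈ J, ∀ z ∈ A, ¬ (∀ i, blk i = j → z i = p i)).card ≤
      2 ^ bsize blk k * (Y.filter fun y => ∀ i, blk i = k → y i = x i).card := by
  refine le_trans (Finset.card_le_card ?_) (card_sat_le blk k Y x)
  intro y hy
  rw [Finset.mem_filter] at hy ⊢
  obtain ⟨hyY, A, p, hyA, hAY, hdim, hmiss⟩ := hy
  exact ⟨hyY, fun w hw => sat_of_tight_of_missed blk Y A hAY y hyA J p hmiss hdim y hyA k hk w hw⟩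

end Summit.PneNP.PneNP.Theorems.ClusCoordSkewSat
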